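import Summits.BirchSwinnertonDyer.BirchSwinnertonDyer.Theorems.KimAtThreeD7uTamagawaDefectExponent
import Summits.BirchSwinnertonDyer.BirchSwinnertonDyer.Theorems.KimAtThreeD7uTamagawaKodairaNeron
import Summits.BirchSwinnertonDyer.BirchSwinnertonDyer.Theorems.KimAtThreeD7uKolyvaginPairBlochKato
import Summits.BirchSwinnertonDyer.BirchSwinnertonDyer.Theorems.KimAtThreeD7uTamagawaFreeStructures
import HarnessLib

/-!
# The TAMAGAWA-DIVISIBLE bad places, XV: «TamDiv∞» at Kolyvagin-system level — `3^{k+1} ∣ c_ℓ ⇒`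
# every Kolyvagin system for [MR04] Remark A.5's `𝓕_u` on `E[3^{k+1}]` VANISHES (Büyükboduk 2009
# Thm. 3.1 / Cor. 3.3 for `T₃E` at the exponent `k + 1 ≤ v₃(c_ℓ)`, every reduction type, from the
# Tamagawa number alone)
# (cell `bsd-addord`, seat w2-tamdiv gen 5; route W2 `KimAtThreeKolyvagin`, items 19562 / 19679 / 19599 /
# 19560, «TamDiv∞»)

HONEST FRAMING: TOOL theorems (no definition, no named fact, no `sorry`); closes nothing by itself;
nothing is booked; BSD is not proved by any of this.  CONDITIONAL on the displayed binders of part XIII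
(Poitou–Tate family `inv` at `3`, Tate's local Euler–Poincaré characteristic `hEP`, the level-one prime
choice `hprime`, n1011's all-depth tower data: no `Γ_ℚ`-fixed point on any `E[3^j·3]`, (H.2)-shape
cokernels for `τ`, canonical admissible Kolyvagin data `D j` with ONE prime set and ONE `η`).  No Euler
system is asserted: the theorems are about Kolyvagin systems; seat gen 2's
`KimAtThreeD7uKolyvaginPairBlochKato.exists_isKolyvaginSystem_pair_blochKatoSelmerStructure_of_unramified_odd`
is what turns a Kato-type Euler system of `T₃E` into a Kolyvagin system for exactly the structure below.

## What (assembly of parts IX–XIV)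

* §1 `blochKatoSelmerStructure_relaxed_le_blochKatoUpdate` (odd `p`, any `k`, any finite `ℓ`): [MR04]'s
  `𝓕_u = blochKatoSelmerStructure p (tateTorsionDatum W p k) ⊤` (relaxed above `p`) lies in Büyükboduk's
  `𝓕_{u-ℓ}^{(k)} = (𝓕_can off ℓ, 𝓕_u(ℓ) at ℓ)` — equal at `∞` (part VI §3), at `p` (gen 2), at `ℓ`; `≤` at
  the other finite places (gen 2).
* §2 **`kolyvaginSystems_blochKatoUpdate_eq_bot_of_pow_succ_dvd`**: `3^{k+1} ∣ c_ℓ ⇒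
  KS(E[3^k·3], 𝓕_{u-ℓ}^{(k)}, D k) = 0` — part XIII with its two local hypotheses (`3 ∣ c_ℓ`,
  `Φ_ℓ[3^k] ⊆ 3Φ_ℓ`) discharged by part XIV (Kodaira–Néron) from `3^{k+1} ∣ c_ℓ` alone.
* §3 **`kolyvaginSystems_blochKatoRelaxed_eq_bot_of_pow_succ_dvd`** and the element form
  **`isKolyvaginSystem_blochKatoRelaxed_apply_eq_zero_of_pow_succ_dvd`**: under `3^{k+1} ∣ c_ℓ`,
  **`KS(E[3^k·3], 𝓕_u, D k) = 0`** for [MR04] Remark A.5's structure `𝓕_u`; so every class `κ_d` of a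
  Kolyvagin system for `𝓕_u` on `E[3^{k+1}]` — in particular every Kolyvagin derivative class of a
  Kato-type Euler system of `T₃E` (gen 2) — is ZERO in `H¹(ℚ, E[3^{k+1}])`: the Euler system is divisible
  by `3^{k+1}` at every Kolyvagin level whenever `3^{k+1}` divides ONE Tamagawa number.  This is the
  Kolyvagin-system form of the route's «TamDiv∞» (deep Kurihara numbers divisible by the `3`-part of a
  Tamagawa number), for one Tamagawa prime, modulo the W2 port between Kurihara numbers and Kolyvagin
  classes.

What is NOT here: several Tamagawa primes simultaneously (exponent `v₃(∏ c_ℓ)`); the `T₃E`-level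
statement `κ ∈ 3ⁿ KS(T₃E)` ([MR04] Thm. 5.2.10 freeness); any Kurihara-number statement.
References: K. Büyükboduk, JNT 129 (2009) Thm. 3.1, Cor. 3.3; B. Mazur, K. Rubin, Mem. AMS 799 (2004)
Prop. 6.2.6, App. A Remark A.5; J. H. Silverman, *ATAEC* Cor. IV.9.2 (d).
-/

noncomputable section

-- the cell's Theorems namespace `Summit.BirchSwinnertonDyer.BirchSwinnertonDyer.…` repeats the summit name by design (D-0017)
set_option linter.dupNamespace false

open scoped Classical NumberField ContRepresentation
open Function Field NumberField IsDedekindDomain Module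
open WeierstrassCurve Literature.NumberTheory.EllipticCurves Literature.NumberTheory.GaloisRepresentations
  Literature.NumberTheory.GaloisRepresentations.DiscreteGaloisModule Literature.NumberTheory.GaloisCohomology
open Summit.BirchSwinnertonDyer.Rank1Residual.GaloisImage
open Summit.BirchSwinnertonDyer.BirchSwinnertonDyer.Theorems.KimAtThreeD7uTamagawaCartesian
open Summit.BirchSwinnertonDyer.BirchSwinnertonDyer.Theorems.KimAtThreeD7uTamagawaDefect
open Summit.BirchSwinnertonDyer.BirchSwinnertonDyer.Theorems.KimAtThreeD7uBlochKatoCondition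
open Summit.BirchSwinnertonDyer.BirchSwinnertonDyer.Theorems.KimAtThreeD7uKolyvaginPairBlochKato
open Summit.BirchSwinnertonDyer.BirchSwinnertonDyer.Theorems.KimAtThreeD7uTamagawaFreeStructures

namespace Summit.BirchSwinnertonDyer.BirchSwinnertonDyer.Theorems.KimAtThreeD7uTamagawaDefectDevissage

/-! ### §1 [MR04]'s `𝓕_u` (relaxed above `p`) lies in `𝓕_{u-ℓ}` -/

section Compare

variable (W : WeierstrassCurve ℚ) [W.IsElliptic] (p : ℕ) [hp : Fact p.Prime] (k : ℕ)

/-- **`𝓕_u ≤ 𝓕_{u-ℓ}^{(k)}`** for odd `p` and any finite `ℓ`: [MR04] Remark A.5's structure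
`blochKatoSelmerStructure p (tateTorsionDatum W p k) ⊤` (unramified/finite condition at every `w ∤ p`,
relaxed = `𝓕_can` at `p`) is contained in Büyükboduk's `𝓕_{u-ℓ}` (canonical off `ℓ`, `𝓕_u(ℓ)` at `ℓ`):
equality at `∞` (`H¹(ℝ, E[p^{k+1}]) = 0`, part VI) and at `w ∣ p` (gen 2), `𝓕_u(w) ≤ 𝓕_can(w)` at finite
`w ∤ p` (gen 2), equality at `ℓ`. [cite: MazurRubin2004, App. A Remark A.5 (p. 81)]
[cite: Buyukboduk2009TamagawaDefect, §3 (the structure `𝓕_{u-ℓ}`)] -/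
theorem blochKatoSelmerStructure_relaxed_le_blochKatoUpdate (hp2 : p ≠ 2) (ℓ : HeightOneSpectrum (𝓞 ℚ)) :
    blochKatoSelmerStructure p (tateTorsionDatum W p k) (fun _ _ => ⊤) ≤
      Function.update (propagatedSelmerStructure W p k) (Sum.inr ℓ)
        (blochKatoSelmerStructure p (tateTorsionDatum W p k) (fun _ _ => ⊤) (Sum.inr ℓ)) := by
  intro v
  by_cases hv : v = Sum.inr ℓ
  · subst hv
    rw [Function.update_self]
  · rw [Function.update_of_ne hv]
    cases v with
    | inl vinf => exact (blochKatoSelmerStructure_inl_eq_propagatedSelmerStructure_of_odd W p k hp2 _ vinf).le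
    | inr w =>
      by_cases hw : ((p : ℕ) : 𝓞 ℚ) ∈ w.asIdeal
      · exact (blochKatoSelmerStructure_relaxed_inr_eq_propagatedSelmerStructure W p k w hw).le
      · exact blochKatoSelmerStructure_inr_le_propagatedSelmerStructure W p k w _ hw

end Compare

/-! ### §2–§3 `p = 3`: the defect from `3^{k+1} ∣ c_ℓ` alone -/

section Three

variable (W : WeierstrassCurve ℚ) [W.IsElliptic]

/-- Local notation: `𝓕_{u-ℓ}^{(j)}` (as in parts XII–XIII). -/
local notation3 "𝓕uℓ[" W' ", " ℓ' ", " j ", " L' "]" =>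
  Function.update (propagatedSelmerStructure W' 3 j) (Sum.inr ℓ')
    (blochKatoSelmerStructure 3 (tateTorsionDatum W' 3 j) L' (Sum.inr ℓ'))

/-- **`3^{k+1} ∣ c_ℓ ⇒ KS(E[3^k·3], 𝓕_{u-ℓ}^{(k)}, D k) = 0`** (part XIII with both local hypotheses —
`3 ∣ c_ℓ` and `Φ_ℓ[3^k] ⊆ 3Φ_ℓ` — discharged from `3^{k+1} ∣ c_ℓ` by Kodaira–Néron, part XIV): the
Tamagawa defect of Büyükboduk 2009 Cor. 2.8 / Thm. 3.1 for `T₃E` at the exponent `k + 1 ≤ v₃(c_ℓ)`, for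
every reduction type at `ℓ`.  Binders as in part XIII.
[cite: Buyukboduk2009TamagawaDefect, Cor. 2.8, Thm. 3.1 and Cor. 3.3] [cite: MazurRubin2004, Prop. 6.2.6 and App. A Remark A.5] -/
theorem kolyvaginSystems_blochKatoUpdate_eq_bot_of_pow_succ_dvd [Finite (geomTorsion W ((3 : ℕ) : ℤ))]
    [Finite (geomTorsion W (((3 : ℕ) : ℤ) ^ 0 * ((3 : ℕ) : ℤ)))]
    {inv : LocalInvariants ℚ 3}
    (hperf : inv.IsPerfect) (hsum : inv.SumLocalTermEqZero) (hcompl : inv.SelmerComplement)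
    (hEP : ∀ v : HeightOneSpectrum (𝓞 ℚ), localEulerPoincareCharacteristic (v.adicCompletion ℚ))
    (T : Finset (HeightOneSpectrum (𝓞 ℚ)))
    (h3T : ∀ v : HeightOneSpectrum (𝓞 ℚ), ((3 : ℕ) : 𝓞 ℚ) ∈ v.asIdeal → v ∈ T)
    (hbadT : ∀ v : HeightOneSpectrum (𝓞 ℚ), ¬ W.HasGoodReductionAt v → v ∈ T)
    {ℓ : HeightOneSpectrum (𝓞 ℚ)} (h3ℓ : ((3 : ℕ) : 𝓞 ℚ) ∉ ℓ.asIdeal) (k : ℕ)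
    (hk : 3 ^ (k + 1) ∣ (W.baseChange (ℓ.adicCompletion ℚ)).localTamagawaNumber (ℓ.adicCompletionIntegers ℚ))
    (L : (j : ℕ) → (tateTorsionDatum W 3 j).LocalConditionsAbove 3)
    (h0 : ∀ (j : ℕ) (P : geomTorsion W (((3 : ℕ) : ℤ) ^ j * ((3 : ℕ) : ℤ))),
      (∀ σ : absoluteGaloisGroup ℚ,
        W.torsionGaloisModule (((3 : ℕ) : ℤ) ^ j * ((3 : ℕ) : ℤ)) σ P = P) → P = 0)
    {Sset : Set (HeightOneSpectrum (𝓞 ℚ))} {τ : absoluteGaloisGroup ℚ}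
    (hτ : ∀ j : ℕ, Nonempty (cokerSubOne (W.torsionGaloisModule (((3 : ℕ) : ℤ) ^ j * ((3 : ℕ) : ℤ))) τ ≃+
      ZMod (3 ^ (j + 1))))
    (hτ₁ : Nonempty (cokerSubOne (W.torsionGaloisModule ((3 : ℕ) : ℤ)) τ ≃+ ZMod 3))
    (hτμ : τ ∈ rootsOfUnityFixer ℚ (3 ^ (k + 1)))
    (D : (j : ℕ) → KolyvaginDatum (W.torsionGaloisModule (((3 : ℕ) : ℤ) ^ j * ((3 : ℕ) : ℤ))))
    {P : Set (HeightOneSpectrum (𝓞 ℚ))} (hP : ∀ j, (D j).primes = P) (hPT : ∀ q ∈ P, q ∉ T)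
    (hPc : P ⊆ frobeniusClassPrimes
      (W.torsionGaloisModule (((3 : ℕ) : ℤ) ^ k * ((3 : ℕ) : ℤ))) Sset τ (3 ^ (k + 1)))
    (hT : ∀ j, (D j).transverse = cyclotomicTransverse _)
    {η : (q : HeightOneSpectrum (𝓞 ℚ)) → (ZMod (Ideal.absNorm q.asIdeal))ˣ}
    (hD : ∀ j, (D j).HasCanonicalComparison (3 ^ (j + 1)) η) (hadm : ∀ j, (D j).IsAdmissible)
    (hprime : ∀ c : galoisCohomology (W.torsionGaloisModule (((3 : ℕ) : ℤ) ^ 0 * ((3 : ℕ) : ℤ))) 1, c ≠ 0 →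
      ∀ c' : galoisCohomology (DiscreteGaloisModule.tateDual
        (W.torsionGaloisModule (((3 : ℕ) : ℤ) ^ 0 * ((3 : ℕ) : ℤ))) 3) 1, c' ≠ 0 →
      {q ∈ (D 0).primes |
        galoisCohomology.localization (W.torsionGaloisModule (((3 : ℕ) : ℤ) ^ 0 * ((3 : ℕ) : ℤ)))
          (Sum.inr q) 1 c ≠ 0 ∧
        galoisCohomology.localization (DiscreteGaloisModule.tateDual
          (W.torsionGaloisModule (((3 : ℕ) : ℤ) ^ 0 * ((3 : ℕ) : ℤ))) 3) (Sum.inr q) 1 c' ≠ 0}.Infinite) :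
    (D k).kolyvaginSystems 𝓕uℓ[W, ℓ, k, L k] = ⊥ := by
  haveI : Fact (Nat.Prime 3) := ⟨Nat.prime_three⟩
  have hc : 3 ∣ (W.baseChange (ℓ.adicCompletion ℚ)).localTamagawaNumber (ℓ.adicCompletionIntegers ℚ) :=
    (dvd_pow_self 3 (Nat.succ_ne_zero k)).trans hk
  exact kolyvaginSystems_blochKatoUpdate_eq_bot W hperf hsum hcompl hEP T h3T hbadT h3ℓ hc L h0 hτ hτ₁ D
    hP hPT hT hD hadm hprime k
    (componentQuotient_torsionBy_le_smul_of_pow_succ_dvd W 3 k ℓ (by norm_num) hk) hτμ hPc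

/-- **«TamDiv∞» at Kolyvagin-system level: `3^{k+1} ∣ c_ℓ ⇒ KS(E[3^k·3], 𝓕_u, D k) = 0`** for [MR04]
Remark A.5's structure `𝓕_u = blochKatoSelmerStructure 3 (tateTorsionDatum W 3 k) ⊤` — the structure for
which a Kato-type Euler system of `T₃E` yields Kolyvagin systems (seat gen 2,
`exists_isKolyvaginSystem_pair_blochKatoSelmerStructure_of_unramified_odd`).  §2 + §1 + monotonicity
of `KS` in the structure (part IX). [cite: Buyukboduk2009TamagawaDefect, Thm. 3.1 and Cor. 3.3]
[cite: MazurRubin2004, App. A Remark A.5 (p. 81)] -/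
theorem kolyvaginSystems_blochKatoRelaxed_eq_bot_of_pow_succ_dvd [Finite (geomTorsion W ((3 : ℕ) : ℤ))]
    [Finite (geomTorsion W (((3 : ℕ) : ℤ) ^ 0 * ((3 : ℕ) : ℤ)))]
    {inv : LocalInvariants ℚ 3}
    (hperf : inv.IsPerfect) (hsum : inv.SumLocalTermEqZero) (hcompl : inv.SelmerComplement)
    (hEP : ∀ v : HeightOneSpectrum (𝓞 ℚ), localEulerPoincareCharacteristic (v.adicCompletion ℚ))
    (T : Finset (HeightOneSpectrum (𝓞 ℚ)))
    (h3T : ∀ v : HeightOneSpectrum (𝓞 ℚ), ((3 : ℕ) : 𝓞 ℚ) ∈ v.asIdeal → v ∈ T)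
    (hbadT : ∀ v : HeightOneSpectrum (𝓞 ℚ), ¬ W.HasGoodReductionAt v → v ∈ T)
    {ℓ : HeightOneSpectrum (𝓞 ℚ)} (h3ℓ : ((3 : ℕ) : 𝓞 ℚ) ∉ ℓ.asIdeal) (k : ℕ)
    (hk : 3 ^ (k + 1) ∣ (W.baseChange (ℓ.adicCompletion ℚ)).localTamagawaNumber (ℓ.adicCompletionIntegers ℚ))
    (h0 : ∀ (j : ℕ) (P : geomTorsion W (((3 : ℕ) : ℤ) ^ j * ((3 : ℕ) : ℤ))),
      (∀ σ : absoluteGaloisGroup ℚ,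
        W.torsionGaloisModule (((3 : ℕ) : ℤ) ^ j * ((3 : ℕ) : ℤ)) σ P = P) → P = 0)
    {Sset : Set (HeightOneSpectrum (𝓞 ℚ))} {τ : absoluteGaloisGroup ℚ}
    (hτ : ∀ j : ℕ, Nonempty (cokerSubOne (W.torsionGaloisModule (((3 : ℕ) : ℤ) ^ j * ((3 : ℕ) : ℤ))) τ ≃+
      ZMod (3 ^ (j + 1))))
    (hτ₁ : Nonempty (cokerSubOne (W.torsionGaloisModule ((3 : ℕ) : ℤ)) τ ≃+ ZMod 3))
    (hτμ : τ ∈ rootsOfUnityFixer ℚ (3 ^ (k + 1)))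
    (D : (j : ℕ) → KolyvaginDatum (W.torsionGaloisModule (((3 : ℕ) : ℤ) ^ j * ((3 : ℕ) : ℤ))))
    {P : Set (HeightOneSpectrum (𝓞 ℚ))} (hP : ∀ j, (D j).primes = P) (hPT : ∀ q ∈ P, q ∉ T)
    (hPc : P ⊆ frobeniusClassPrimes
      (W.torsionGaloisModule (((3 : ℕ) : ℤ) ^ k * ((3 : ℕ) : ℤ))) Sset τ (3 ^ (k + 1)))
    (hT : ∀ j, (D j).transverse = cyclotomicTransverse _)
    {η : (q : HeightOneSpectrum (𝓞 ℚ)) → (ZMod (Ideal.absNorm q.asIdeal))ˣ}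
    (hD : ∀ j, (D j).HasCanonicalComparison (3 ^ (j + 1)) η) (hadm : ∀ j, (D j).IsAdmissible)
    (hprime : ∀ c : galoisCohomology (W.torsionGaloisModule (((3 : ℕ) : ℤ) ^ 0 * ((3 : ℕ) : ℤ))) 1, c ≠ 0 →
      ∀ c' : galoisCohomology (DiscreteGaloisModule.tateDual
        (W.torsionGaloisModule (((3 : ℕ) : ℤ) ^ 0 * ((3 : ℕ) : ℤ))) 3) 1, c' ≠ 0 →
      {q ∈ (D 0).primes |
        galoisCohomology.localization (W.torsionGaloisModule (((3 : ℕ) : ℤ) ^ 0 * ((3 : ℕ) : ℤ)))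
          (Sum.inr q) 1 c ≠ 0 ∧
        galoisCohomology.localization (DiscreteGaloisModule.tateDual
          (W.torsionGaloisModule (((3 : ℕ) : ℤ) ^ 0 * ((3 : ℕ) : ℤ))) 3) (Sum.inr q) 1 c' ≠ 0}.Infinite) :
    (D k).kolyvaginSystems (blochKatoSelmerStructure 3 (tateTorsionDatum W 3 k) (fun _ _ => ⊤)) = ⊥ := by
  haveI : Fact (Nat.Prime 3) := ⟨Nat.prime_three⟩
  have h := kolyvaginSystems_blochKatoUpdate_eq_bot_of_pow_succ_dvd W hperf hsum hcompl hEP T h3T hbadT h3ℓ k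
    hk (fun j => fun _ _ => ⊤) h0 hτ hτ₁ hτμ D hP hPT hPc hT hD hadm hprime
  exact le_bot_iff.mp ((kolyvaginSystems_mono (D k)
    (blochKatoSelmerStructure_relaxed_le_blochKatoUpdate W 3 k (by norm_num) ℓ)).trans h.le)

/-- **Element form: every class of a Kolyvagin system for `𝓕_u` on `E[3^{k+1}]` VANISHES when `3^{k+1}`
divides a Tamagawa number `c_ℓ` (`ℓ ≠ 3`)** — e.g. every Kolyvagin derivative class `κ_d` of a Kato-type
Euler system of `T₃E` (seat gen 2's Kolyvagin systems for exactly this structure): the Euler system is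
divisible by `3^{k+1}` at every Kolyvagin level (Büyükboduk Cor. 3.3 «`κ^{Kato} ∈ 3ⁿ KS`», `n = k + 1`,
at finite level, for every reduction type at `ℓ`). [cite: Buyukboduk2009TamagawaDefect, Thm. 3.1 and Cor. 3.3]
[cite: MazurRubin2004, Prop. 6.2.6 and App. A Remark A.5] -/
theorem isKolyvaginSystem_blochKatoRelaxed_apply_eq_zero_of_pow_succ_dvd [Finite (geomTorsion W ((3 : ℕ) : ℤ))]
    [Finite (geomTorsion W (((3 : ℕ) : ℤ) ^ 0 * ((3 : ℕ) : ℤ)))]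
    {inv : LocalInvariants ℚ 3}
    (hperf : inv.IsPerfect) (hsum : inv.SumLocalTermEqZero) (hcompl : inv.SelmerComplement)
    (hEP : ∀ v : HeightOneSpectrum (𝓞 ℚ), localEulerPoincareCharacteristic (v.adicCompletion ℚ))
    (T : Finset (HeightOneSpectrum (𝓞 ℚ)))
    (h3T : ∀ v : HeightOneSpectrum (𝓞 ℚ), ((3 : ℕ) : 𝓞 ℚ) ∈ v.asIdeal → v ∈ T)
    (hbadT : ∀ v : HeightOneSpectrum (𝓞 ℚ), ¬ W.HasGoodReductionAt v → v ∈ T)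
    {ℓ : HeightOneSpectrum (𝓞 ℚ)} (h3ℓ : ((3 : ℕ) : 𝓞 ℚ) ∉ ℓ.asIdeal) (k : ℕ)
    (hk : 3 ^ (k + 1) ∣ (W.baseChange (ℓ.adicCompletion ℚ)).localTamagawaNumber (ℓ.adicCompletionIntegers ℚ))
    (h0 : ∀ (j : ℕ) (P : geomTorsion W (((3 : ℕ) : ℤ) ^ j * ((3 : ℕ) : ℤ))),
      (∀ σ : absoluteGaloisGroup ℚ,
        W.torsionGaloisModule (((3 : ℕ) : ℤ) ^ j * ((3 : ℕ) : ℤ)) σ P = P) → P = 0)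
    {Sset : Set (HeightOneSpectrum (𝓞 ℚ))} {τ : absoluteGaloisGroup ℚ}
    (hτ : ∀ j : ℕ, Nonempty (cokerSubOne (W.torsionGaloisModule (((3 : ℕ) : ℤ) ^ j * ((3 : ℕ) : ℤ))) τ ≃+
      ZMod (3 ^ (j + 1))))
    (hτ₁ : Nonempty (cokerSubOne (W.torsionGaloisModule ((3 : ℕ) : ℤ)) τ ≃+ ZMod 3))
    (hτμ : τ ∈ rootsOfUnityFixer ℚ (3 ^ (k + 1)))
    (D : (j : ℕ) → KolyvaginDatum (W.torsionGaloisModule (((3 : ℕ) : ℤ) ^ j * ((3 : ℕ) : ℤ))))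
    {P : Set (HeightOneSpectrum (𝓞 ℚ))} (hP : ∀ j, (D j).primes = P) (hPT : ∀ q ∈ P, q ∉ T)
    (hPc : P ⊆ frobeniusClassPrimes
      (W.torsionGaloisModule (((3 : ℕ) : ℤ) ^ k * ((3 : ℕ) : ℤ))) Sset τ (3 ^ (k + 1)))
    (hT : ∀ j, (D j).transverse = cyclotomicTransverse _)
    {η : (q : HeightOneSpectrum (𝓞 ℚ)) → (ZMod (Ideal.absNorm q.asIdeal))ˣ}
    (hD : ∀ j, (D j).HasCanonicalComparison (3 ^ (j + 1)) η) (hadm : ∀ j, (D j).IsAdmissible)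
    (hprime : ∀ c : galoisCohomology (W.torsionGaloisModule (((3 : ℕ) : ℤ) ^ 0 * ((3 : ℕ) : ℤ))) 1, c ≠ 0 →
      ∀ c' : galoisCohomology (DiscreteGaloisModule.tateDual
        (W.torsionGaloisModule (((3 : ℕ) : ℤ) ^ 0 * ((3 : ℕ) : ℤ))) 3) 1, c' ≠ 0 →
      {q ∈ (D 0).primes |
        galoisCohomology.localization (W.torsionGaloisModule (((3 : ℕ) : ℤ) ^ 0 * ((3 : ℕ) : ℤ)))
          (Sum.inr q) 1 c ≠ 0 ∧
        galoisCohomology.localization (DiscreteGaloisModule.tateDual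
          (W.torsionGaloisModule (((3 : ℕ) : ℤ) ^ 0 * ((3 : ℕ) : ℤ))) 3) (Sum.inr q) 1 c' ≠ 0}.Infinite)
    {κ : Finset (HeightOneSpectrum (𝓞 ℚ)) →
      galoisCohomology (W.torsionGaloisModule (((3 : ℕ) : ℤ) ^ k * ((3 : ℕ) : ℤ))) 1}
    (hκ : (D k).IsKolyvaginSystem (blochKatoSelmerStructure 3 (tateTorsionDatum W 3 k) (fun _ _ => ⊤)) κ)
    (d : Finset (HeightOneSpectrum (𝓞 ℚ))) : κ d = 0 := by
  have h := kolyvaginSystems_blochKatoRelaxed_eq_bot_of_pow_succ_dvd W hperf hsum hcompl hEP T h3T hbadT h3ℓ k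
    hk h0 hτ hτ₁ hτμ D hP hPT hPc hT hD hadm hprime
  exact congrFun ((AddSubgroup.eq_bot_iff_forall _).mp h κ
    ((KolyvaginDatum.mem_kolyvaginSystems_iff _ _ _).2 hκ)) d

end Three

end Summit.BirchSwinnertonDyer.BirchSwinnertonDyer.Theorems.KimAtThreeD7uTamagawaDefectDevissage

end
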